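import Summits.AtomisticToContinuum.Crystallization.Theorems.HullExactificationCascadeRobustBarlowTemplateDevelopZChart
import Summits.AtomisticToContinuum.Crystallization.Theorems.HullExactificationCascadeRobustBarlowTemplateTransportSteps1
import Summits.AtomisticToContinuum.Crystallization.Theorems.HullExactificationCascadeRobustBarlowTemplateTransportGlobalC
import Summits.AtomisticToContinuum.Crystallization.Theorems.HullExactificationCascadeRobustBarlowTemplateTransportGlobalD
import Summits.AtomisticToContinuum.Crystallization.Theorems.HullExactificationCascadeRobustBarlowTemplateTransportGlobalF

/-!
# Stub `develop_transport` for line `registered` (crux `RobustBarlowTemplate`, stmt-AtomisticToContinuum-12088)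

The registered skeleton stub `develop_transport` (skeleton stub 2a): a nonempty `δ`-separated
configuration `S ⊆ ℝ³` all of whose points are `1/20`-good and whose shell relation is reciprocal
with comparable scales (`Recip S`) carries a TRANSPORT SYSTEM (`TransportSystem S` of
`…RobustBarlowTemplateTransportDefs`: three commuting frame transports `I, J, V` with an
`I, J`-invariant parity, STAR = the twelve `linkOffsets` frames around `f` are mapped by `pt`
bijectively onto the first shell of `pt f`, LINK = shell-adjacency among them is `linkAdj`).

## Proof outline (port of `transportSystem_of_connected` of the closed sibling crux 9227,
`PalmUnimodularRigidityShellsToBarlowChartTransportGlobalG.lean`, WITHOUT the reachability clause)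
* scale-relative integer charts at every site: `develop_zchart` (chosen into families
  `Pc, Ac, nb` with `hch : ∀ z ∈ S, IsZChart S z (Pc z) (Ac z) (nb z)`); symmetry of the shell
  relation `hsy` is the first conjunct of `Recip`;
* a base frame of parity `+1` in the base regime: at an HCP site if there is one, else (all sites
  FCC, by `pattern_cases`) at any site (`S.Nonempty`), the frames being explicit label triples
  checked by `decide`;
* the development `frameAt Pc nb g₀ k i j` is valid with sites in `S` (`layers`, part `GlobalC`),
  its parity is `I, J`-invariant (`par_IJ`) and STAR/LINK hold at every frame (`star_at`, part
  `GlobalF`, with the letter below read by `lowerParity_eq_par_below`);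
* the frame type is `ℤ³` with the three coordinate shifts as `I, J, V` (they commute
  definitionally), `pt f := (frameAt … f).pt`, `par f :=` the parity of `frameAt … f`.
-/

noncomputable section

namespace Summit.AtomisticToContinuum.Crystallization.Theorems.HullExactificationCascadeRobustBarlowTemplate

open Literature.Geometry.DiscreteGeometry Literature.MathematicalPhysics.StatisticalMechanics
open Summit.AtomisticToContinuum.Crystallization.Theorems.PalmUnimodularRigidityShellsToBarlowChart hiding
  IsZChart TransportSystem scales_tied sqNormInt_transfer bond_symm nb_mem zlab_spec zlab_nb bond_nb_iff
  pattern_cases transfer_nb_nb transfer_nb_centre transfer_nb_target sqNormInt_zlab_centre hcp_of_mirror_pair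
  Istep_spec Jstep_spec IinvStep_spec JinvStep_spec capWithAny_of_mem_cap IinvStep_Istep Istep_IinvStep
  JinvStep_Jstep Jstep_JinvStep polar_at_apex onesided_at_apex nb_inj Istep_lower Jstep_lower
  IinvStep_lower JinvStep_lower Vstep_spec polar_at_lower_apex onesided_at_lower_apex VinvStep_spec
  attach_I_even attach_I_odd attach_lower_I_pos attach_lower_I_neg attach_J_even attach_J_odd
  Vstep_Istep_pt Vstep_Istep_back Vstep_Istep_side Vstep_Jstep_pt Vstep_Istep_comm Vstep_Jstep_comm
  attach_lower_J_pos attach_lower_J_neg VinvStep_Istep_pt VinvStep_Jstep_pt VinvStep_Istep_back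
  VinvStep_Istep_side Istep_Jstep_comm line_I line_J adm_transports layer_zero back_I back_J nbhd
  layer_up layer_down layers star_core table_fcc_p table_fcc_m table_hcp_p table_hcp_m sites_inlayer
  up_of_V up_of_Vinv down_of_Vinv down_of_V sites par_IJ lowerParity_eq_par_below star_at

/-- Euclidean `3`-space. -/
local notation "E3" => EuclideanSpace ℝ (Fin 3)

/-- **Stub `develop_transport`** (skeleton stub 2a): the transport system of a nonempty
separated everywhere-good configuration with reciprocal shells — scale-relative integer charts
at every site (`develop_zchart`), frames transported along `I, J` (in-layer) and `V, V⁻¹` (across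
layers) with the orientation carried by the caps, coherence of the development (`layers`),
STAR/LINK read off the label table of each site (`star_at`); the frame type is `ℤ³` with the
coordinate shifts. [folklore] -/
theorem develop_transport : ∀ δ : ℝ, 0 < δ → ∀ S : Set E3, S.Nonempty → Sep δ S → (∀ y ∈ S, Good S y) → Recip S → TransportSystem S := by
  intro δ hδ S hne hsep hgood hR
  classical
  -- scale-relative integer charts everywhere
  have hch0 : ∀ x : E3, ∃ (P : Finset (Fin 3 → ℤ)) (A : E3 →ₗᵢ[ℝ] E3) (nbr : (Fin 3 → ℤ) → E3),
      x ∈ S → IsZChart S x P A nbr := by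
    intro x
    by_cases hx : x ∈ S
    · obtain ⟨P, A, nbr, h⟩ := develop_zchart δ hδ S hsep hgood hR x hx
      exact ⟨P, A, nbr, fun _ => h⟩
    · exact ⟨∅, LinearIsometry.id, fun _ => 0, fun h => (hx h).elim⟩
  choose Pc Ac nb hch using hch0
  -- symmetry of the shell relation
  have hsy : ∀ x ∈ S, ∀ y ∈ shell S x, x ∈ shell S y := fun x hx y hy => (hR x hx y hy).1
  -- a base frame of parity `+1`, in the base regime
  have hbase : ∃ g₀ : ZFrame, IsFrame (Pc g₀.pt) g₀.t₁ g₀.t₂ g₀.U ∧ g₀.pt ∈ S ∧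
      frameParity g₀.t₁ g₀.t₂ g₀.U = 1 ∧ ((∀ z ∈ S, Pc z = fcc3Int) ∨ Pc g₀.pt = hcpInt) := by
    by_cases hB : ∃ x₀ ∈ S, Pc x₀ = hcpInt
    · obtain ⟨x₀, hx₀, hP⟩ := hB
      refine ⟨⟨x₀, ![-3, 3, 0], ![-3, 0, 3], {![0, 3, 3], ![3, 0, 3], ![3, 3, 0]}⟩, ?_, hx₀, ?_, Or.inr hP⟩
      · show IsFrame (Pc x₀) ![-3, 3, 0] ![-3, 0, 3] {![0, 3, 3], ![3, 0, 3], ![3, 3, 0]}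
        rw [hP]; decide
      · show frameParity ![-3, 3, 0] ![-3, 0, 3] {![0, 3, 3], ![3, 0, 3], ![3, 3, 0]} = 1
        decide
    · push Not at hB
      obtain ⟨x₀, hx₀⟩ := hne
      have hF : ∀ z ∈ S, Pc z = fcc3Int := fun z hz => (pattern_cases hch hz).resolve_right (hB z hz)
      refine ⟨⟨x₀, ![3, 3, 0], ![3, 0, 3], {![0, 3, 3], ![-3, 0, 3], ![-3, 3, 0]}⟩, ?_, hx₀, ?_, Or.inl hF⟩
      · show IsFrame (Pc x₀) ![3, 3, 0] ![3, 0, 3] {![0, 3, 3], ![-3, 0, 3], ![-3, 3, 0]}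
        rw [hF x₀ hx₀]; decide
      · show frameParity ![3, 3, 0] ![3, 0, 3] {![0, 3, 3], ![-3, 0, 3], ![-3, 3, 0]} = 1
        decide
  obtain ⟨g₀, h₀, h₀S, h₀p, h₀A⟩ := hbase
  obtain ⟨-, hS, -, -, -, -⟩ := layers (Pc := Pc) (nb := nb) hch hsy h₀ h₀S h₀p h₀A
  -- the three shifts of `ℤ³`
  let Ish : Equiv.Perm (ℤ × ℤ × ℤ) :=
    ⟨fun f => (f.1, f.2.1 + 1, f.2.2), fun f => (f.1, f.2.1 - 1, f.2.2), fun f => by simp, fun f => by simp⟩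
  let Jsh : Equiv.Perm (ℤ × ℤ × ℤ) :=
    ⟨fun f => (f.1, f.2.1, f.2.2 + 1), fun f => (f.1, f.2.1, f.2.2 - 1), fun f => by simp, fun f => by simp⟩
  let Vsh : Equiv.Perm (ℤ × ℤ × ℤ) :=
    ⟨fun f => (f.1 + 1, f.2.1, f.2.2), fun f => (f.1 - 1, f.2.1, f.2.2), fun f => by simp, fun f => by simp⟩
  have hI1 : ∀ f, Ish f = (f.1, f.2.1 + 1, f.2.2) := fun f => rfl
  have hI2 : ∀ f, Ish⁻¹ f = (f.1, f.2.1 - 1, f.2.2) := fun f => rfl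
  have hJ1 : ∀ f, Jsh f = (f.1, f.2.1, f.2.2 + 1) := fun f => rfl
  have hJ2 : ∀ f, Jsh⁻¹ f = (f.1, f.2.1, f.2.2 - 1) := fun f => rfl
  have hV1 : ∀ f, Vsh f = (f.1 + 1, f.2.1, f.2.2) := fun f => rfl
  have hV2 : ∀ f, Vsh⁻¹ f = (f.1 - 1, f.2.1, f.2.2) := fun f => rfl
  have hIpow : ∀ (n : ℤ) (f : ℤ × ℤ × ℤ), (Ish ^ n) f = (f.1, f.2.1 + n, f.2.2) := by
    intro n
    induction n using Int.induction_on with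
    | zero => intro f; simp
    | succ n ih =>
      intro f; rw [zpow_add_one, Equiv.Perm.mul_apply, ih, hI1]
      refine Prod.ext rfl (Prod.ext ?_ rfl); dsimp only; ring
    | pred n ih =>
      intro f; rw [zpow_sub_one, Equiv.Perm.mul_apply, ih, hI2]
      refine Prod.ext rfl (Prod.ext ?_ rfl); dsimp only; ring
  have hJpow : ∀ (n : ℤ) (f : ℤ × ℤ × ℤ), (Jsh ^ n) f = (f.1, f.2.1, f.2.2 + n) := by
    intro n
    induction n using Int.induction_on with
    | zero => intro f; simp
    | succ n ih =>
      intro f; rw [zpow_add_one, Equiv.Perm.mul_apply, ih, hJ1]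
      refine Prod.ext rfl (Prod.ext rfl ?_); dsimp only; ring
    | pred n ih =>
      intro f; rw [zpow_sub_one, Equiv.Perm.mul_apply, ih, hJ2]
      refine Prod.ext rfl (Prod.ext rfl ?_); dsimp only; ring
  have hVpow : ∀ (n : ℤ) (f : ℤ × ℤ × ℤ), (Vsh ^ n) f = (f.1 + n, f.2.1, f.2.2) := by
    intro n
    induction n using Int.induction_on with
    | zero => intro f; simp
    | succ n ih =>
      intro f; rw [zpow_add_one, Equiv.Perm.mul_apply, ih, hV1]
      refine Prod.ext ?_ rfl; dsimp only; ring
    | pred n ih =>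
      intro f; rw [zpow_sub_one, Equiv.Perm.mul_apply, ih, hV2]
      refine Prod.ext ?_ rfl; dsimp only; ring
  -- the composite used in STAR / LINK
  have hcomp : ∀ (f : ℤ × ℤ × ℤ) (y : ℤ × ℤ × ℤ),
      (Vsh ^ y.1) ((Jsh ^ (-y.2.2)) ((Ish ^ (-y.2.1)) f)) = (f.1 + y.1, f.2.1 - y.2.1, f.2.2 - y.2.2) := by
    intro f y
    rw [hIpow, hJpow, hVpow]
    refine Prod.ext rfl (Prod.ext ?_ ?_) <;> dsimp only <;> ring
  -- points and parities
  let ptF : ℤ × ℤ × ℤ → E3 := fun f => (frameAt Pc nb g₀ f.1 f.2.1 f.2.2).pt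
  let par : ℤ × ℤ × ℤ → ℤ := fun f =>
    frameParity (frameAt Pc nb g₀ f.1 f.2.1 f.2.2).t₁ (frameAt Pc nb g₀ f.1 f.2.1 f.2.2).t₂
      (frameAt Pc nb g₀ f.1 f.2.1 f.2.2).U
  -- STAR / LINK at `f`
  have hstar : ∀ f : ℤ × ℤ × ℤ,
      Set.BijOn (fun y : ℤ × ℤ × ℤ => ptF ((Vsh ^ y.1) ((Jsh ^ (-y.2.2)) ((Ish ^ (-y.2.1)) f))))
        (↑(linkOffsets (par (Vsh⁻¹ f)) (par f)) : Set (ℤ × ℤ × ℤ)) (shell S (ptF f)) ∧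
      ∀ y ∈ linkOffsets (par (Vsh⁻¹ f)) (par f), ∀ y' ∈ linkOffsets (par (Vsh⁻¹ f)) (par f),
        (ptF ((Vsh ^ y'.1) ((Jsh ^ (-y'.2.2)) ((Ish ^ (-y'.2.1)) f))) ∈
            shell S (ptF ((Vsh ^ y.1) ((Jsh ^ (-y.2.2)) ((Ish ^ (-y.2.1)) f)))) ↔
          linkAdj (par (Vsh⁻¹ f)) (par f) y y') := by
    intro f
    rcases h : frameAt Pc nb g₀ f.1 f.2.1 f.2.2 with ⟨x, t₁, t₂, U⟩
    have hσp : frameParity t₁ t₂ U = par f := by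
      show _ = frameParity _ _ _; rw [h]
    have hσm : lowerParity t₁ t₂ (lowerCap (Pc x) t₁ t₂ U) = par (Vsh⁻¹ f) := by
      have := lowerParity_eq_par_below (Pc := Pc) (nb := nb) hch hsy h₀ h₀S h₀p h₀A f.1 f.2.1 f.2.2
      rw [h] at this
      exact this
    have hx : ptF f = x := by show (frameAt Pc nb g₀ f.1 f.2.1 f.2.2).pt = x; rw [h]
    obtain ⟨hbij, hlink⟩ := star_at hch hsy h₀ h₀S h₀p h₀A f.1 f.2.1 f.2.2 h hσp hσm
    have e : (fun y : ℤ × ℤ × ℤ => ptF ((Vsh ^ y.1) ((Jsh ^ (-y.2.2)) ((Ish ^ (-y.2.1)) f)))) =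
        fun y : ℤ × ℤ × ℤ => (frameAt Pc nb g₀ (f.1 + y.1) (f.2.1 - y.2.1) (f.2.2 - y.2.2)).pt := by
      funext y; simp only [ptF, hcomp]
    refine ⟨?_, ?_⟩
    · rw [e, hx]; exact hbij
    · intro y hy y' hy'
      have := hlink y hy y' hy'
      simp only [ptF, hcomp]
      exact this
  exact ⟨ℤ × ℤ × ℤ, ptF, Ish, Jsh, Vsh, par, ((0 : ℤ), (0 : ℤ), (0 : ℤ)), fun f => rfl, fun f => rfl, fun f => rfl,
    fun f => hS f.1 f.2.1 f.2.2, fun f => frameParity_eq_or _ _ _,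
    fun f => (par_IJ (Pc := Pc) (nb := nb) hch hsy h₀ h₀S h₀p h₀A f.1 f.2.1 f.2.2).1,
    fun f => (par_IJ (Pc := Pc) (nb := nb) hch hsy h₀ h₀S h₀p h₀A f.1 f.2.1 f.2.2).2,
    fun f => (hstar f).1, fun f => (hstar f).2⟩

end Summit.AtomisticToContinuum.Crystallization.Theorems.HullExactificationCascadeRobustBarlowTemplate

end
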